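/-
Copyright (c) 2026 the pub-hodgecm-mathlib formalisation cell (harness21).  Prover seat hodgecm-mathlib-F0P3a-p01 (g36), req620 Track A «(D-RAM) FOUR-FRAME» squad — STAGE-1b
(D-1b) §3: FIRST HAND on `stub_law_levHi` ∕ `stub_law_levLo`; the SPLIT-STRATA CELLS of the binder (L2b-κS) of ★ `F0P3cDyRamLevKappaSignModelSumOfLabelledStageB` (this seat):
the κ-side twin of LH4-p09 (g8)'s ★ p859094 `LabelledSplitStrata`, with TWO tokens.  Helper lane `--supports stmt-HodgeConjecture-24833`.  2026-09-04.
-/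
import Summits.HodgeConjecture.HodgeConjecture.Theorems.F0P3cDyRamLabelledSplitStrata            -- ★ p859094 (LH4-p09 (g8)): token reads `latticeInLevel_diagonal_{stdLattice,latt_T1,latt_T2,latt_T3}_iff`, `finsum_mem_sep_eq_ite_of_forall_iff`; brings ★ B4 `hasAxis_axis{1,2,3}_iff`
import Summits.HodgeConjecture.HodgeConjecture.Theorems.F0P3cDyRamDiagonalKappaSplitCountSockets   -- ★ p856661 (LH4-p04 (g2)): the four UNLABELLED type-0 κ-sockets `finsum_kappaCount_mul_stabiliserWeight_hasAxis_{core,T1,T2,T3}`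
import HarnessLib

/-!
# Crux `H413`, line LH4 «(D-RAM) FOUR-FRAME» road, STAGE 1b — THE LABELLED κ-SOCKETS OF THE FOUR SPLIT STRATA (core, T₁, T₂, T₃) WITH TWO DIAGONAL TOKENS:
# `Σᶠ_{M ∈ stratum(a), diag(e₁)M ⊆ ϖ^ℓ₁M ∧ diag(e₂)M ⊆ ϖ^ℓ₂M} κ₀,ᵢ(M)·w(M) = [read₁(a) ∧ read₂(a)] · ‹★ unlabelled κ-socket(a)›`

Cell `hodgecm-mathlib` (D-0151), FLOOR 0, crux item H413 = `stmt-HodgeConjecture-24833`, route of record `HCCMUnconditional`; squads F0∕P3c∕LH4 ∕ F0∕P3a.  THEOREMS ONLY (no `def`,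
no instance, no notation, no `sorry`, default heartbeats); lane `--supports stmt-HodgeConjecture-24833 --as helper` (count-neutral).

WHY.  After ★ `F0P3cDyRamLevKappaSignModelSumOfLabelledStageB` (this seat, (L2c)) the two tier-0 ED. 5 level stubs `stub_law_levHi ∕ stub_law_levLo` cost EXACTLY one sentence each,
(L2b-κS): `Σᶠ_{M ∈ 𝓛₀(T), D₁M ⊆ ϖ^{la}M ∧ D₂M ⊆ ϖ^{lb}M} κ₀,ᵢ(M)·w(M) = (Ω_i·w_i·S_i)·A∕4` (`D₁ = diag(a²−1, b²−1, 0)`, `D₂ = D₁²`).  Its proof is the unit's ★ (κS-B₀²) road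
(★ `KappaCountTypeZero` ∕ `…Signed`: ★ PART 1 partition of `𝓛₀(T)` by axis vector, the seven ★ κ-sockets cell by cell, ★ κ-BOX-SUM) with the two-token label riding in every cell.
THIS FILE pays the four SPLIT cells (axis vectors `(0,0,0)`, `(0,s,s)`, `(s,0,s)`, `(s,s,0)`): there the label is CONSTANT on the stratum — LH4-p09 (g8)'s ★ reads
`latticeInLevel_diagonal_{stdLattice, latt_T1, latt_T2, latt_T3}_iff` (the token on the stratum's HNF model `latt[…]`, ★ B4 `hasAxis_axis{1,2,3}_iff`) — so by his ★
`finsum_mem_sep_eq_ite_of_forall_iff` (generic in the summand) the labelled κ-cell is the indicator of the two reads times LH4-p04 (g2)'s ★ unlabelled κ-socket (★ p856661).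
Generic in BOTH tokens `(ℓ₁, e₁)`, `(ℓ₂, e₂)` (§2); the MODEL instances `e₁ = (α−1, β−1, 0)`, `e₂ = ((α−1)², (β−1)², 0)` with the reads spelled in the element datum's depths where
they are depth letters (§3: T₁ reads `n₁ ≥ ℓ₁ + s ∧ 2n₁ ≥ ℓ₂ + s`, T₂ reads `n₂ ≥ ℓ₁ + s ∧ 2n₂ ≥ ℓ₂ + s`; T₃'s second read `|(β−1)² − (α−1)²| ≤ |ϖ|^{ℓ₂+s}` = `n₃ + v(α+β−2) ≥ ℓ₂ + s`
is NOT a depth letter — `v(α+β−2) = v((α−β) + 2(β−1))` reads `t = v(2)` — and is carried as a valuation; the core cell is `0` with or without label).  The glued ∕ core-hanging cells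
(G₁ G₂ G₃ H), where the label CUTS the stratum along the glue invariant (LH4-p09 (g8) ★ p859518 `LabelledGluedClassCut`, `LabelledGluedLocusCensus*`, `LabelledCoreHangingLocusCensus`),
and the labelled κ-BOX-SUM are the remaining cells of (L2b-κS) — not here.
HONEST LABEL.  Count-neutral (`--supports`): kernel identities about the diagonal model (lattice counting), NOT census laws, NOT literature facts; pays no tier-0 row; (L2b-κS) and the
STAGE-1b rows stay PROVER TARGETS; `HC_CM` is proved only modulo the 7 printed citations (2 remaining named inputs: hLiu418 = `stmt-HodgeConjecture-24832`, h413 =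
`stmt-HodgeConjecture-24833`) until rung 0 closes.

## References
* [Kottwitz1986BaseChangeUnits] R. E. Kottwitz, *Base change for unit elements of Hecke algebras*, Compositio Math. 60 (1986), §1 pp. 240–241 (κ-orbital integrals of units as
  signed lattice counts modulo the torus; congruence conditions on fixed lattices).
* [Rogawski1990] J. D. Rogawski, *Automorphic Representations of Unitary Groups in Three Variables*, Ann. of Math. Stud. 123 (1990), §4.9 Prop. 4.9.1 (a)(b) p. 55, §4.10 p. 58.
* [Serre1980Trees] J.-P. Serre, *Trees*, Springer (1980), Ch. II §1.1.
* [Serre1979] J.-P. Serre, *Local Fields*, GTM 67 (1979), Ch. V §3 Prop. 5, Cor. 3.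
-/

set_option autoImplicit false

noncomputable section

namespace Summit.HodgeConjecture.HodgeConjecture.Cruxes.H413.F0P3cDyRamLabelledKappaSplitStrata

open Literature.NumberTheory.Automorphic Literature.NumberTheory.Automorphic.HermitianLattice
open Literature.NumberTheory.Automorphic.UnitaryLatticeTree Literature.NumberTheory.Automorphic.UnitaryThreeFourFrame
open Summit.HodgeConjecture.HodgeConjecture.Cruxes.H413.F0P3cDyRamDiagonalTorusDefs
open Summit.HodgeConjecture.HodgeConjecture.Cruxes.H413.F0P3cDyRamDiagonalStrataDefs
open Summit.HodgeConjecture.HodgeConjecture.Cruxes.H413.F0P3cDyRamDiagonalKappaCountDefs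
open Summit.HodgeConjecture.HodgeConjecture.Cruxes.H413.F0P3cDyRamDiagonalSplitCountSockets
open Summit.HodgeConjecture.HodgeConjecture.Cruxes.H413.F0P3cDyRamDiagonalKappaSplitCountSockets
open Summit.HodgeConjecture.HodgeConjecture.Cruxes.H413.F0P3cDyRamFourFrameCensusDefs
open Summit.HodgeConjecture.HodgeConjecture.Cruxes.H413.F0P3cDyRamLevelTokenHNF
open Summit.HodgeConjecture.HodgeConjecture.Cruxes.H413.F0P3cDyRamLabelledSplitStrata
open scoped Valued WithZero Matrix MatrixGroups

/-! ## §1  Two labels constant on a set factor out as ONE indicator -/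

section Sep

/-- If `Q₁ ↔ P₁` and `Q₂ ↔ P₂` on all of `S`, then `Σᶠ_{a ∈ S, Q₁ a ∧ Q₂ a} w(a) = [P₁ ∧ P₂]·Σᶠ_{a ∈ S} w(a)` (★ `finsum_mem_sep_eq_ite_of_forall_iff` at `Q := Q₁ ∧ Q₂`).
[cite: Serre1980Trees, II §1.1] -/
theorem finsum_mem_sep_and_eq_ite_of_forall_iff {γ : Type*} (S : Set γ) (Q₁ Q₂ : γ → Prop) (P₁ P₂ : Prop) [Decidable (P₁ ∧ P₂)]
    (h₁ : ∀ a ∈ S, Q₁ a ↔ P₁) (h₂ : ∀ a ∈ S, Q₂ a ↔ P₂) (w : γ → ℚ) :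
    ∑ᶠ a ∈ {a | a ∈ S ∧ (Q₁ a ∧ Q₂ a)}, w a = if P₁ ∧ P₂ then ∑ᶠ a ∈ S, w a else 0 :=
  finsum_mem_sep_eq_ite_of_forall_iff S (fun a => Q₁ a ∧ Q₂ a) (P₁ ∧ P₂) (fun a ha => and_congr (h₁ a ha) (h₂ a ha)) w

end Sep

/-! ## §2  The four labelled κ-cells, generic tokens `(ℓ₁, diag e₁)`, `(ℓ₂, diag e₂)` -/

section Cells

variable {K : Type} [Field K] [Valued K ℤᵐ⁰] [Fintype 𝓀[K]] [CompleteSpace K] {σ : K →+* K} {ϖ : K} {d t : ℕ} {α β : K} {N₀ n₁ n₂ n₃ : ℕ} {T : GL (Fin 3) K}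

/-- **LABELLED κ-CORE**: the core stratum is `{𝒪³}` and `κ₀,ᵢ(𝒪³)·w = 0` summed (★ `finsum_kappaCount_mul_stabiliserWeight_hasAxis_core`), so the label-cut sum is `0` for ANY two
tokens (the cut set is a subset of a stratum every member of which is `𝒪³`; on it both tokens read the constants `|e_i| ≤ |ϖ|^ℓ`, ★ `latticeInLevel_diagonal_stdLattice_iff`).
[cite: Kottwitz1986BaseChangeUnits, §1 pp. 240–241] [cite: Rogawski1990, §4.10 p. 58] -/
theorem finsum_kappaCount_mul_stabiliserWeight_core_sep_two (hD : IsRamifiedQuadraticDatum σ ϖ d t) (hE : IsElementDatum σ ϖ N₀ α β n₁ n₂ n₃)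
    (hT : (T : Matrix (Fin 3) (Fin 3) K) = Matrix.diagonal ![α, β, 1]) (i : Fin 3) (ℓ₁ ℓ₂ : ℕ) (e₁ e₂ : Fin 3 → K) :
    ∑ᶠ M ∈ {M | M ∈ stratum σ ϖ T ![0, 0, 0] ∧ (LatticeInLevel ϖ ℓ₁ (Matrix.diagonal e₁) M ∧ LatticeInLevel ϖ ℓ₂ (Matrix.diagonal e₂) M)},
        (kappaCount σ ϖ 0 i M : ℚ) * stabiliserWeight σ M = 0 := by
  classical
  have hϖ : Valued.v ϖ = WithZero.exp (-1 : ℤ) := hD.2.2.1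
  have hϖ0 : ϖ ≠ 0 := fun h0 => by rw [h0, map_zero] at hϖ; exact WithZero.coe_ne_zero hϖ.symm
  -- every member of the core stratum is `𝒪³`
  have hmem : ∀ M ∈ stratum σ ϖ T ![0, 0, 0], M = stdLattice K 3 := by
    rintro M ⟨⟨-, -, hN⟩, -, hax⟩
    refine le_antisymm (fun w hw => mem_stdLattice.2 fun j => (hN j).1 w hw) (fun w hw => ?_)
    have hw' : ∀ j, Valued.v (w j) ≤ 1 := fun j => mem_stdLattice.1 hw j
    rw [← Finset.univ_sum_single w]
    refine M.sum_mem fun j _ => ?_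
    have e0 : ((![0, 0, 0] : Fin 3 → ℕ) j) = 0 := by fin_cases j <;> rfl
    exact (hax j (w j)).2 (by rw [e0, pow_zero]; exact hw' j)
  rw [finsum_mem_sep_and_eq_ite_of_forall_iff (stratum σ ϖ T ![0, 0, 0]) _ _ _ _
      (fun M hM => by rw [hmem M hM, latticeInLevel_diagonal_stdLattice_iff hϖ0 ℓ₁ e₁])
      (fun M hM => by rw [hmem M hM, latticeInLevel_diagonal_stdLattice_iff hϖ0 ℓ₂ e₂]),
    finsum_kappaCount_mul_stabiliserWeight_hasAxis_core hD hE hT i]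
  split_ifs <;> rfl

/-- **LABELLED κ-T₁ `(0,s,s)`** (`s ≥ 1`): `Σᶠ_{M ∈ stratum(0,s,s), two tokens} κ₀,ᵢ(M)·w(M) = [reads] · (ω(−1)·q^{s∕2} if i = 0 ∧ 2d ≤ s ∧ 2 ∣ s ∧ s ≤ n₁, else 0)`, the reads being
`(∀ j, |e₁ j| ≤ |ϖ|^{ℓ₁}) ∧ |e₁ 2 − e₁ 1| ≤ |ϖ|^{ℓ₁+s}` and the same for `(ℓ₂, e₂)` (★ `latticeInLevel_diagonal_latt_T1_iff` on ★ `hasAxis_axis1_iff`'s model; ★ p856661 T₁ socket).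
[cite: Kottwitz1986BaseChangeUnits, §1 pp. 240–241] [cite: Rogawski1990, §4.9 Prop. 4.9.1 (a) p. 55] [cite: Serre1979, Ch. V §3 Prop. 5, Cor. 3] -/
theorem finsum_kappaCount_mul_stabiliserWeight_T1_sep_two (hD : IsRamifiedQuadraticDatum σ ϖ d t) (hE : IsElementDatum σ ϖ N₀ α β n₁ n₂ n₃)
    (hT : (T : Matrix (Fin 3) (Fin 3) K) = Matrix.diagonal ![α, β, 1]) (s : ℕ) (hs : 1 ≤ s) (i : Fin 3) (ℓ₁ ℓ₂ : ℕ) (e₁ e₂ : Fin 3 → K) :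
    ∑ᶠ M ∈ {M | M ∈ stratum σ ϖ T ![0, s, s] ∧ (LatticeInLevel ϖ ℓ₁ (Matrix.diagonal e₁) M ∧ LatticeInLevel ϖ ℓ₂ (Matrix.diagonal e₂) M)},
        (kappaCount σ ϖ 0 i M : ℚ) * stabiliserWeight σ M =
      if ((Valued.v (e₁ 0) ≤ Valued.v ϖ ^ ℓ₁ ∧ Valued.v (e₁ 1) ≤ Valued.v ϖ ^ ℓ₁ ∧ Valued.v (e₁ 2) ≤ Valued.v ϖ ^ ℓ₁) ∧
            Valued.v (e₁ 2 - e₁ 1) ≤ Valued.v ϖ ^ (ℓ₁ + s)) ∧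
          ((Valued.v (e₂ 0) ≤ Valued.v ϖ ^ ℓ₂ ∧ Valued.v (e₂ 1) ≤ Valued.v ϖ ^ ℓ₂ ∧ Valued.v (e₂ 2) ≤ Valued.v ϖ ^ ℓ₂) ∧
            Valued.v (e₂ 2 - e₂ 1) ≤ Valued.v ϖ ^ (ℓ₂ + s)) then
        (if i = 0 ∧ 2 * d ≤ s ∧ 2 ∣ s ∧ s ≤ n₁ then (normSign σ (-1 : K) : ℚ) * (Fintype.card 𝓀[K] : ℚ) ^ (s / 2) else 0)
      else 0 := by
  classical
  have hϖ : Valued.v ϖ = WithZero.exp (-1 : ℤ) := hD.2.2.1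
  have hϖ0 : ϖ ≠ 0 := fun h0 => by rw [h0, map_zero] at hϖ; exact WithZero.coe_ne_zero hϖ.symm
  rw [finsum_mem_sep_and_eq_ite_of_forall_iff (stratum σ ϖ T ![0, s, s]) _ _ _ _
      (fun M hM => by
        obtain ⟨z, hz, rfl⟩ := (hasAxis_axis1_iff hϖ hM.1 hs).1 hM.2.2
        exact latticeInLevel_diagonal_latt_T1_iff hϖ0 ℓ₁ s e₁ hz)
      (fun M hM => by
        obtain ⟨z, hz, rfl⟩ := (hasAxis_axis1_iff hϖ hM.1 hs).1 hM.2.2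
        exact latticeInLevel_diagonal_latt_T1_iff hϖ0 ℓ₂ s e₂ hz),
    finsum_kappaCount_mul_stabiliserWeight_hasAxis_T1 hD hE hT s hs i]

/-- **LABELLED κ-T₂ `(s,0,s)`** (`s ≥ 1`): `[reads] · (ω(−1)·q^{s∕2} if i = 1 ∧ 2d ≤ s ∧ 2 ∣ s ∧ s ≤ n₂, else 0)`, reads `(∀ j, |e j| ≤ |ϖ|^ℓ) ∧ |e 2 − e 0| ≤ |ϖ|^{ℓ+s}` for both tokens
(★ `latticeInLevel_diagonal_latt_T2_iff`, ★ `hasAxis_axis2_iff`, ★ p856661 T₂ socket). [cite: Kottwitz1986BaseChangeUnits, §1 pp. 240–241] [cite: Rogawski1990, §4.9 Prop. 4.9.1 (a) p. 55] [cite: Serre1979, Ch. V §3 Prop. 5, Cor. 3] -/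
theorem finsum_kappaCount_mul_stabiliserWeight_T2_sep_two (hD : IsRamifiedQuadraticDatum σ ϖ d t) (hE : IsElementDatum σ ϖ N₀ α β n₁ n₂ n₃)
    (hT : (T : Matrix (Fin 3) (Fin 3) K) = Matrix.diagonal ![α, β, 1]) (s : ℕ) (hs : 1 ≤ s) (i : Fin 3) (ℓ₁ ℓ₂ : ℕ) (e₁ e₂ : Fin 3 → K) :
    ∑ᶠ M ∈ {M | M ∈ stratum σ ϖ T ![s, 0, s] ∧ (LatticeInLevel ϖ ℓ₁ (Matrix.diagonal e₁) M ∧ LatticeInLevel ϖ ℓ₂ (Matrix.diagonal e₂) M)},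
        (kappaCount σ ϖ 0 i M : ℚ) * stabiliserWeight σ M =
      if ((Valued.v (e₁ 0) ≤ Valued.v ϖ ^ ℓ₁ ∧ Valued.v (e₁ 1) ≤ Valued.v ϖ ^ ℓ₁ ∧ Valued.v (e₁ 2) ≤ Valued.v ϖ ^ ℓ₁) ∧
            Valued.v (e₁ 2 - e₁ 0) ≤ Valued.v ϖ ^ (ℓ₁ + s)) ∧
          ((Valued.v (e₂ 0) ≤ Valued.v ϖ ^ ℓ₂ ∧ Valued.v (e₂ 1) ≤ Valued.v ϖ ^ ℓ₂ ∧ Valued.v (e₂ 2) ≤ Valued.v ϖ ^ ℓ₂) ∧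
            Valued.v (e₂ 2 - e₂ 0) ≤ Valued.v ϖ ^ (ℓ₂ + s)) then
        (if i = 1 ∧ 2 * d ≤ s ∧ 2 ∣ s ∧ s ≤ n₂ then (normSign σ (-1 : K) : ℚ) * (Fintype.card 𝓀[K] : ℚ) ^ (s / 2) else 0)
      else 0 := by
  classical
  have hϖ : Valued.v ϖ = WithZero.exp (-1 : ℤ) := hD.2.2.1
  have hϖ0 : ϖ ≠ 0 := fun h0 => by rw [h0, map_zero] at hϖ; exact WithZero.coe_ne_zero hϖ.symm
  rw [finsum_mem_sep_and_eq_ite_of_forall_iff (stratum σ ϖ T ![s, 0, s]) _ _ _ _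
      (fun M hM => by
        obtain ⟨y, hy, rfl⟩ := (hasAxis_axis2_iff hϖ hM.1 hs).1 hM.2.2
        exact latticeInLevel_diagonal_latt_T2_iff hϖ0 ℓ₁ s e₁ hy)
      (fun M hM => by
        obtain ⟨y, hy, rfl⟩ := (hasAxis_axis2_iff hϖ hM.1 hs).1 hM.2.2
        exact latticeInLevel_diagonal_latt_T2_iff hϖ0 ℓ₂ s e₂ hy),
    finsum_kappaCount_mul_stabiliserWeight_hasAxis_T2 hD hE hT s hs i]

/-- **LABELLED κ-T₃ `(s,s,0)`** (`s ≥ 1`): `[reads] · (ω(−1)·q^{s∕2} if i = 2 ∧ 2d ≤ s ∧ 2 ∣ s ∧ s ≤ n₃, else 0)`, reads `(∀ j, |e j| ≤ |ϖ|^ℓ) ∧ |e 1 − e 0| ≤ |ϖ|^{ℓ+s}` for both tokens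
(★ `latticeInLevel_diagonal_latt_T3_iff`, ★ `hasAxis_axis3_iff`, ★ p856661 T₃ socket). [cite: Kottwitz1986BaseChangeUnits, §1 pp. 240–241] [cite: Rogawski1990, §4.9 Prop. 4.9.1 (a) p. 55] [cite: Serre1979, Ch. V §3 Prop. 5, Cor. 3] -/
theorem finsum_kappaCount_mul_stabiliserWeight_T3_sep_two (hD : IsRamifiedQuadraticDatum σ ϖ d t) (hE : IsElementDatum σ ϖ N₀ α β n₁ n₂ n₃)
    (hT : (T : Matrix (Fin 3) (Fin 3) K) = Matrix.diagonal ![α, β, 1]) (s : ℕ) (hs : 1 ≤ s) (i : Fin 3) (ℓ₁ ℓ₂ : ℕ) (e₁ e₂ : Fin 3 → K) :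
    ∑ᶠ M ∈ {M | M ∈ stratum σ ϖ T ![s, s, 0] ∧ (LatticeInLevel ϖ ℓ₁ (Matrix.diagonal e₁) M ∧ LatticeInLevel ϖ ℓ₂ (Matrix.diagonal e₂) M)},
        (kappaCount σ ϖ 0 i M : ℚ) * stabiliserWeight σ M =
      if ((Valued.v (e₁ 0) ≤ Valued.v ϖ ^ ℓ₁ ∧ Valued.v (e₁ 1) ≤ Valued.v ϖ ^ ℓ₁ ∧ Valued.v (e₁ 2) ≤ Valued.v ϖ ^ ℓ₁) ∧
            Valued.v (e₁ 1 - e₁ 0) ≤ Valued.v ϖ ^ (ℓ₁ + s)) ∧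
          ((Valued.v (e₂ 0) ≤ Valued.v ϖ ^ ℓ₂ ∧ Valued.v (e₂ 1) ≤ Valued.v ϖ ^ ℓ₂ ∧ Valued.v (e₂ 2) ≤ Valued.v ϖ ^ ℓ₂) ∧
            Valued.v (e₂ 1 - e₂ 0) ≤ Valued.v ϖ ^ (ℓ₂ + s)) then
        (if i = 2 ∧ 2 * d ≤ s ∧ 2 ∣ s ∧ s ≤ n₃ then (normSign σ (-1 : K) : ℚ) * (Fintype.card 𝓀[K] : ℚ) ^ (s / 2) else 0)
      else 0 := by
  classical
  have hϖ : Valued.v ϖ = WithZero.exp (-1 : ℤ) := hD.2.2.1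
  have hϖ0 : ϖ ≠ 0 := fun h0 => by rw [h0, map_zero] at hϖ; exact WithZero.coe_ne_zero hϖ.symm
  rw [finsum_mem_sep_and_eq_ite_of_forall_iff (stratum σ ϖ T ![s, s, 0]) _ _ _ _
      (fun M hM => by
        obtain ⟨x, hx, rfl⟩ := (hasAxis_axis3_iff hϖ hM.1 hs).1 hM.2.2
        exact latticeInLevel_diagonal_latt_T3_iff hϖ0 ℓ₁ s e₁ hx)
      (fun M hM => by
        obtain ⟨x, hx, rfl⟩ := (hasAxis_axis3_iff hϖ hM.1 hs).1 hM.2.2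
        exact latticeInLevel_diagonal_latt_T3_iff hϖ0 ℓ₂ s e₂ hx),
    finsum_kappaCount_mul_stabiliserWeight_hasAxis_T3 hD hE hT s hs i]

end Cells

/-! ## §3  The MODEL tokens `D₁ = diag(α−1, β−1, 0)`, `D₂ = diag((α−1)², (β−1)², 0)` of the element datum: the reads in depth letters -/

section Model

variable {K : Type} [Field K] [Valued K ℤᵐ⁰] [Fintype 𝓀[K]] [CompleteSpace K] {σ : K →+* K} {ϖ : K} {d t : ℕ} {α β : K} {N₀ n₁ n₂ n₃ : ℕ} {T : GL (Fin 3) K}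

omit [Fintype 𝓀[K]] [CompleteSpace K] in
/-- The absolute read of a depth letter: `|x| = |ϖ|^n ⇒ (|x| ≤ |ϖ|^ℓ ↔ ℓ ≤ n)` (`|ϖ| = exp(−1)`). [cite: Rogawski1990, §4.9 Prop. 4.9.1 (a) p. 55] -/
theorem v_le_pow_iff_of_eq (hD : IsRamifiedQuadraticDatum σ ϖ d t) {x : K} {n : ℕ} (hx : Valued.v x = Valued.v ϖ ^ n) (ℓ : ℕ) :
    Valued.v x ≤ Valued.v ϖ ^ ℓ ↔ ℓ ≤ n := by
  have hϖ : Valued.v ϖ = WithZero.exp (-1 : ℤ) := hD.2.2.1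
  have hq : ∀ m : ℕ, Valued.v ϖ ^ m = WithZero.exp (-(m : ℤ)) := fun m => by
    rw [hϖ, ← WithZero.exp_nsmul]
    congr 1
    simp
  rw [hx, hq, hq, WithZero.exp_le_exp]
  constructor <;> intro h <;> omega

omit [Fintype 𝓀[K]] [CompleteSpace K] in
/-- The absolute read of a squared depth letter: `|x| = |ϖ|^n ⇒ (|x·x| ≤ |ϖ|^ℓ ↔ ℓ ≤ 2n)`. [cite: Rogawski1990, §4.9 Prop. 4.9.1 (a) p. 55] -/
theorem v_mul_self_le_pow_iff_of_eq (hD : IsRamifiedQuadraticDatum σ ϖ d t) {x : K} {n : ℕ} (hx : Valued.v x = Valued.v ϖ ^ n) (ℓ : ℕ) :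
    Valued.v (x * x) ≤ Valued.v ϖ ^ ℓ ↔ ℓ ≤ 2 * n := by
  have h2 : Valued.v (x * x) = Valued.v ϖ ^ (2 * n) := by rw [map_mul, hx, ← pow_add, two_mul]
  exact v_le_pow_iff_of_eq hD h2 ℓ

/-- **LABELLED κ-T₁ AT THE MODEL TOKENS** (levels `ℓ₁`, `ℓ₂`): the reads are `ℓ₁ ≤ n₂ ∧ ℓ₁ ≤ n₁ ∧ ℓ₁ + s ≤ n₁` and `ℓ₂ ≤ 2n₂ ∧ ℓ₂ ≤ 2n₁ ∧ ℓ₂ + s ≤ 2n₁` (`e₁ 2 − e₁ 1 = −(β−1)`,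
`e₂ 2 − e₂ 1 = −(β−1)²`): the cell is `ω(−1)·q^{s∕2}` iff `i = 0 ∧ 2d ≤ s ∧ 2 ∣ s ∧ s ≤ n₁ − ℓ₁ ∧ 2s ≤ … ` — i.e. THE UNIT CELL WITH THE `s`-RANGE TRUNCATED BY THE TWO TOKENS.
[cite: Kottwitz1986BaseChangeUnits, §1 pp. 240–241] [cite: Rogawski1990, §4.9 Prop. 4.9.1 (a)(b) p. 55] -/
theorem finsum_kappaCount_mul_stabiliserWeight_T1_sep_levels (hD : IsRamifiedQuadraticDatum σ ϖ d t) (hE : IsElementDatum σ ϖ N₀ α β n₁ n₂ n₃)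
    (hT : (T : Matrix (Fin 3) (Fin 3) K) = Matrix.diagonal ![α, β, 1]) (s : ℕ) (hs : 1 ≤ s) (i : Fin 3) (ℓ₁ ℓ₂ : ℕ) :
    ∑ᶠ M ∈ {M | M ∈ stratum σ ϖ T ![0, s, s] ∧
        (LatticeInLevel ϖ ℓ₁ (Matrix.diagonal ![α - 1, β - 1, 0]) M ∧ LatticeInLevel ϖ ℓ₂ (Matrix.diagonal ![(α - 1) * (α - 1), (β - 1) * (β - 1), 0]) M)},
        (kappaCount σ ϖ 0 i M : ℚ) * stabiliserWeight σ M =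
      if (ℓ₁ ≤ n₂ ∧ ℓ₁ + s ≤ n₁) ∧ (ℓ₂ ≤ 2 * n₂ ∧ ℓ₂ + s ≤ 2 * n₁) then
        (if i = 0 ∧ 2 * d ≤ s ∧ 2 ∣ s ∧ s ≤ n₁ then (normSign σ (-1 : K) : ℚ) * (Fintype.card 𝓀[K] : ℚ) ^ (s / 2) else 0)
      else 0 := by
  classical
  have hα : Valued.v (α - 1) = Valued.v ϖ ^ n₂ := hE.2.2.2.2.2.2.1
  have hβ : Valued.v (β - 1) = Valued.v ϖ ^ n₁ := hE.2.2.2.2.2.1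
  have r1 := v_le_pow_iff_of_eq hD hα
  have r2 := v_le_pow_iff_of_eq hD hβ
  have r1' := v_mul_self_le_pow_iff_of_eq hD hα
  have r2' := v_mul_self_le_pow_iff_of_eq hD hβ
  rw [finsum_kappaCount_mul_stabiliserWeight_T1_sep_two hD hE hT s hs i ℓ₁ ℓ₂]
  have hv0 : ∀ ℓ : ℕ, Valued.v (0 : K) ≤ Valued.v ϖ ^ ℓ := fun ℓ => by rw [map_zero]; exact zero_le
  simp only [Matrix.cons_val_zero, Matrix.cons_val_one, Matrix.cons_val_two, Matrix.tail_cons, Matrix.head_cons, zero_sub, Valuation.map_neg, hv0, and_true,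
    r1, r2, r1', r2']
  by_cases h : (ℓ₁ ≤ n₂ ∧ ℓ₁ + s ≤ n₁) ∧ (ℓ₂ ≤ 2 * n₂ ∧ ℓ₂ + s ≤ 2 * n₁)
  · rw [if_pos h, if_pos ⟨⟨⟨h.1.1, by omega⟩, h.1.2⟩, ⟨h.2.1, by omega⟩, h.2.2⟩]
  · rw [if_neg h, if_neg (fun h' => h ⟨⟨h'.1.1.1, h'.1.2⟩, h'.2.1.1, h'.2.2⟩)]

/-- **LABELLED κ-T₂ AT THE MODEL TOKENS**: reads `ℓ₁ ≤ n₁ ∧ ℓ₁ + s ≤ n₂` and `ℓ₂ ≤ 2n₁ ∧ ℓ₂ + s ≤ 2n₂` (`e 2 − e 0 = −(α−1)`, resp. `−(α−1)²`).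
[cite: Kottwitz1986BaseChangeUnits, §1 pp. 240–241] [cite: Rogawski1990, §4.9 Prop. 4.9.1 (a)(b) p. 55] -/
theorem finsum_kappaCount_mul_stabiliserWeight_T2_sep_levels (hD : IsRamifiedQuadraticDatum σ ϖ d t) (hE : IsElementDatum σ ϖ N₀ α β n₁ n₂ n₃)
    (hT : (T : Matrix (Fin 3) (Fin 3) K) = Matrix.diagonal ![α, β, 1]) (s : ℕ) (hs : 1 ≤ s) (i : Fin 3) (ℓ₁ ℓ₂ : ℕ) :
    ∑ᶠ M ∈ {M | M ∈ stratum σ ϖ T ![s, 0, s] ∧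
        (LatticeInLevel ϖ ℓ₁ (Matrix.diagonal ![α - 1, β - 1, 0]) M ∧ LatticeInLevel ϖ ℓ₂ (Matrix.diagonal ![(α - 1) * (α - 1), (β - 1) * (β - 1), 0]) M)},
        (kappaCount σ ϖ 0 i M : ℚ) * stabiliserWeight σ M =
      if (ℓ₁ ≤ n₁ ∧ ℓ₁ + s ≤ n₂) ∧ (ℓ₂ ≤ 2 * n₁ ∧ ℓ₂ + s ≤ 2 * n₂) then
        (if i = 1 ∧ 2 * d ≤ s ∧ 2 ∣ s ∧ s ≤ n₂ then (normSign σ (-1 : K) : ℚ) * (Fintype.card 𝓀[K] : ℚ) ^ (s / 2) else 0)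
      else 0 := by
  classical
  have hα : Valued.v (α - 1) = Valued.v ϖ ^ n₂ := hE.2.2.2.2.2.2.1
  have hβ : Valued.v (β - 1) = Valued.v ϖ ^ n₁ := hE.2.2.2.2.2.1
  have r1 := v_le_pow_iff_of_eq hD hα
  have r2 := v_le_pow_iff_of_eq hD hβ
  have r1' := v_mul_self_le_pow_iff_of_eq hD hα
  have r2' := v_mul_self_le_pow_iff_of_eq hD hβ
  rw [finsum_kappaCount_mul_stabiliserWeight_T2_sep_two hD hE hT s hs i ℓ₁ ℓ₂]
  have hv0 : ∀ ℓ : ℕ, Valued.v (0 : K) ≤ Valued.v ϖ ^ ℓ := fun ℓ => by rw [map_zero]; exact zero_le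
  simp only [Matrix.cons_val_zero, Matrix.cons_val_one, Matrix.cons_val_two, Matrix.tail_cons, Matrix.head_cons, zero_sub, Valuation.map_neg, hv0, and_true,
    r1, r2, r1', r2']
  by_cases h : (ℓ₁ ≤ n₁ ∧ ℓ₁ + s ≤ n₂) ∧ (ℓ₂ ≤ 2 * n₁ ∧ ℓ₂ + s ≤ 2 * n₂)
  · rw [if_pos h, if_pos ⟨⟨⟨by omega, h.1.1⟩, h.1.2⟩, ⟨by omega, h.2.1⟩, h.2.2⟩]
  · rw [if_neg h, if_neg (fun h' => h ⟨⟨h'.1.1.2, h'.1.2⟩, h'.2.1.2, h'.2.2⟩)]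

/-- **LABELLED κ-T₃ AT THE MODEL TOKENS**: reads `ℓ₁ ≤ n₂ ∧ ℓ₁ ≤ n₁ ∧ ℓ₁ + s ≤ n₃` (`e 1 − e 0 = (β−1) − (α−1) = β − α`) and `ℓ₂ ≤ 2n₂ ∧ ℓ₂ ≤ 2n₁ ∧ |(β−1)² − (α−1)²| ≤ |ϖ|^{ℓ₂+s}`
— the last read, `= |β − α|·|α + β − 2|`, is NOT an element-datum letter (`v(α+β−2) = v((α−β) + 2(β−1))` reads `v(2)`) and is carried as a valuation for the box-sum assembler.
[cite: Kottwitz1986BaseChangeUnits, §1 pp. 240–241] [cite: Rogawski1990, §4.9 Prop. 4.9.1 (a)(b) p. 55] -/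
theorem finsum_kappaCount_mul_stabiliserWeight_T3_sep_levels (hD : IsRamifiedQuadraticDatum σ ϖ d t) (hE : IsElementDatum σ ϖ N₀ α β n₁ n₂ n₃)
    (hT : (T : Matrix (Fin 3) (Fin 3) K) = Matrix.diagonal ![α, β, 1]) (s : ℕ) (hs : 1 ≤ s) (i : Fin 3) (ℓ₁ ℓ₂ : ℕ) :
    ∑ᶠ M ∈ {M | M ∈ stratum σ ϖ T ![s, s, 0] ∧
        (LatticeInLevel ϖ ℓ₁ (Matrix.diagonal ![α - 1, β - 1, 0]) M ∧ LatticeInLevel ϖ ℓ₂ (Matrix.diagonal ![(α - 1) * (α - 1), (β - 1) * (β - 1), 0]) M)},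
        (kappaCount σ ϖ 0 i M : ℚ) * stabiliserWeight σ M =
      if (ℓ₁ ≤ n₂ ∧ ℓ₁ ≤ n₁ ∧ ℓ₁ + s ≤ n₃) ∧
          (ℓ₂ ≤ 2 * n₂ ∧ ℓ₂ ≤ 2 * n₁ ∧ Valued.v ((β - 1) * (β - 1) - (α - 1) * (α - 1)) ≤ Valued.v ϖ ^ (ℓ₂ + s)) then
        (if i = 2 ∧ 2 * d ≤ s ∧ 2 ∣ s ∧ s ≤ n₃ then (normSign σ (-1 : K) : ℚ) * (Fintype.card 𝓀[K] : ℚ) ^ (s / 2) else 0)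
      else 0 := by
  classical
  have hα : Valued.v (α - 1) = Valued.v ϖ ^ n₂ := hE.2.2.2.2.2.2.1
  have hβ : Valued.v (β - 1) = Valued.v ϖ ^ n₁ := hE.2.2.2.2.2.1
  have hαβ : Valued.v (α - β) = Valued.v ϖ ^ n₃ := hE.2.2.2.2.2.2.2.1
  have r1 := v_le_pow_iff_of_eq hD hα
  have r2 := v_le_pow_iff_of_eq hD hβ
  have r1' := v_mul_self_le_pow_iff_of_eq hD hα
  have r2' := v_mul_self_le_pow_iff_of_eq hD hβ
  have r3 : Valued.v (β - 1 - (α - 1)) ≤ Valued.v ϖ ^ (ℓ₁ + s) ↔ ℓ₁ + s ≤ n₃ := by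
    rw [show β - 1 - (α - 1) = -(α - β) by ring, Valuation.map_neg]
    exact v_le_pow_iff_of_eq hD hαβ (ℓ₁ + s)
  rw [finsum_kappaCount_mul_stabiliserWeight_T3_sep_two hD hE hT s hs i ℓ₁ ℓ₂]
  have hv0 : ∀ ℓ : ℕ, Valued.v (0 : K) ≤ Valued.v ϖ ^ ℓ := fun ℓ => by rw [map_zero]; exact zero_le
  simp only [Matrix.cons_val_zero, Matrix.cons_val_one, Matrix.cons_val_two, Matrix.tail_cons, Matrix.head_cons, hv0, and_true, r1, r2, r1', r2', r3, and_assoc]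

end Model

end Summit.HodgeConjecture.HodgeConjecture.Cruxes.H413.F0P3cDyRamLabelledKappaSplitStrata

end
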